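import Literature.Probability.RandomPlanarGeometry.HullDecomposition
import Literature.Probability.RandomPlanarGeometry.HullApproximation
import Summits.CriticalPhenomena.SAWScalingLimit.Theorems.SAWLoopFugacityFlowAvoidanceDeterminesLawStar
import HarnessLib

/-!
# Crux `SAWDevelopingMap.ObservableToSLE` (stmt-CriticalPhenomena-10472), line
`floor-ratio-restriction-bootstrap`: clopen pieces of a `*`-hull are `*`-hulls (helper for STUB 4b)

Landing target:
`Summits/CriticalPhenomena/SAWScalingLimit/Theorems/SAWDevelopingMapObservableToSLEHullApproxPiece.lean`
(`--supports stmt-CriticalPhenomena-10472`).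

For the "hull approximation from outside" (STUB 4b, `stub_hullApproxDomain`) the given `*`-hull
`B` is cut into finitely many CLUSTERS, unions of connected components of `B` grouped by the real
interval they are attached to. This file supplies the component-free part, generalising the
`±`-decomposition of `HullDecomposition` (`sidePart`): if a `*`-hull `A` is the disjoint union of
two closed sets `S`, `S'`, then `S` is again a `*`-hull (`stub_hullApproxDomain_piece`): `S` is
a union of components of `A`, each of which reaches the real axis
(`IsStarHull.exists_real_mem_connectedComponentIn`), so `S ∪ {Im ≤ 0}` is connected; `ℍ ∖ S` is
connected (a piece of it missing `ℍ ∖ A` would be an open subset of `S'` clopen in `ℍ`), hence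
simply connected by Conway VIII.2.2 (`Complex.isSimplyConnected_of_compl`). Also: the set of
points of `A` whose component contains a real point of a closed set `K ⊆ ℝ` is closed
(`isClosed_componentPiece`, the argument of `IsStarHull.isClosed_sidePart`).
-/

noncomputable section

open Set Filter Topology Metric Complex Function
open Literature.Probability.RandomPlanarGeometry
open UpperHalfPlane (upperHalfPlaneSet isOpen_upperHalfPlaneSet)

namespace Summit.CriticalPhenomena.SAWScalingLimit.Theorems.ObservableToSLE.FloorRatio

variable {A : Set ℂ}

/-- **The piece of `A` attached to `K` is closed**: for a `*`-hull `A` and a closed `K ⊆ ℝ`, the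
set of points of `A` whose connected component in `A` contains a real point of `K` is closed (it
is the preimage of the compact image of a closed set in the Hausdorff space of components of the
compact space `A`). [folklore] -/
theorem isClosed_componentPiece (hA : IsStarHull A) {K : Set ℝ} (hK : IsClosed K) :
    IsClosed {a | a ∈ A ∧ ∃ x : ℝ, x ∈ K ∧ (x : ℂ) ∈ connectedComponentIn A a} := by
  -- adapted from `IsStarHull.isClosed_sidePart` (HullDecomposition)
  have hAc : IsClosed A := hA.isBoundedHull.isClosed
  haveI : CompactSpace A := isCompact_iff_compactSpace.1 hA.isBoundedHull.isCompact
  set P : Set A := {t : A | (t : ℂ).im = 0 ∧ (t : ℂ).re ∈ K} with hP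
  have hPc : IsClosed P :=
    (isClosed_eq (continuous_im.comp continuous_subtype_val) continuous_const).inter
      (hK.preimage (continuous_re.comp continuous_subtype_val))
  set Q : Set A := ConnectedComponents.mk ⁻¹' (ConnectedComponents.mk '' P) with hQ
  have hQc : IsClosed Q :=
    ((hPc.isCompact.image ConnectedComponents.continuous_coe).isClosed).preimage
      ConnectedComponents.continuous_coe
  have hQeq : Q = ⋃ t ∈ P, connectedComponent t := connectedComponents_preimage_image P
  have heq : {a | a ∈ A ∧ ∃ x : ℝ, x ∈ K ∧ (x : ℂ) ∈ connectedComponentIn A a} =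
      ((↑) : A → ℂ) '' Q := by
    ext a
    constructor
    · rintro ⟨ha, x, hx, hxa⟩
      rw [connectedComponentIn_eq_image ha] at hxa
      obtain ⟨t, ht, htx⟩ := hxa
      refine ⟨⟨a, ha⟩, ?_, rfl⟩
      rw [hQeq, mem_iUnion₂]
      refine ⟨t, ⟨by rw [htx, ofReal_im], by rw [htx, ofReal_re]; exact hx⟩, ?_⟩
      rw [← connectedComponent_eq ht]
      exact mem_connectedComponent
    · rintro ⟨a', ha', rfl⟩
      rw [hQeq, mem_iUnion₂] at ha'
      obtain ⟨t, ⟨htim, htre⟩, hat⟩ := ha'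
      have htre' : (((t : ℂ).re : ℝ) : ℂ) = t := Complex.ext (by simp) (by simp [htim])
      refine ⟨a'.2, (t : ℂ).re, htre, ?_⟩
      rw [connectedComponentIn_eq_image a'.2, htre']
      refine ⟨t, ?_, rfl⟩
      show t ∈ connectedComponent a'
      rw [← connectedComponent_eq hat]
      exact mem_connectedComponent
  rw [heq]
  exact hAc.isClosedEmbedding_subtypeVal.isClosedMap _ hQc

/-- **`ℍ ∖ S` is connected for a closed-open piece `S` of a `*`-hull `A = S ⊔ S'`**: it contains
the connected `ℍ ∖ A`, and the part of it in an open set missing `ℍ ∖ A` is an open subset of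
`S'` whose closure misses `S`, hence clopen in the connected `ℍ`, hence empty. [folklore] -/
theorem isConnected_diff_piece (hA : IsStarHull A) {S S' : Set ℂ} (hSc : IsClosed S)
    (hS'c : IsClosed S') (hSS' : S ∪ S' = A) (hdisj : Disjoint S S') :
    IsConnected (upperHalfPlaneSet \ S) := by
  have hAb := hA.isBoundedHull
  have hSA : S ⊆ A := hSS' ▸ subset_union_left
  have hU : IsConnected (upperHalfPlaneSet \ A) := hAb.2.2.isPathConnected.isConnected
  have hUsub : upperHalfPlaneSet \ A ⊆ upperHalfPlaneSet \ S := sdiff_subset_sdiff_right hSA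
  refine ⟨hU.nonempty.mono hUsub, ?_⟩
  -- the key step, for `ℍ ∖ A ⊆ u`
  have key : ∀ {u v : Set ℂ}, IsOpen u → IsOpen v → upperHalfPlaneSet \ S ⊆ u ∪ v →
      (upperHalfPlaneSet \ S) ∩ (u ∩ v) = ∅ → upperHalfPlaneSet \ A ⊆ u →
      upperHalfPlaneSet \ S ⊆ u := by
    intro u v hu hv hsuv hsi hUu
    set V := (upperHalfPlaneSet \ S) ∩ v with hV
    have hVo : IsOpen V := (isOpen_upperHalfPlaneSet.sdiff hSc).inter hv
    have hVS' : V ⊆ S' := by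
      rintro z ⟨⟨hzH, hzS⟩, hzv⟩
      have hzA : z ∈ A := by
        by_contra hzA
        have : z ∈ (upperHalfPlaneSet \ S) ∩ (u ∩ v) := ⟨⟨hzH, hzS⟩, hUu ⟨hzH, hzA⟩, hzv⟩
        rw [hsi] at this
        exact this
      exact (hSS'.symm.subset hzA).resolve_left hzS
    have hclV : closure V ⊆ S' := closure_minimal hVS' hS'c
    have hW : IsOpen (upperHalfPlaneSet \ V) := by
      rw [isOpen_iff_mem_nhds]
      rintro p ⟨hpH, hpV⟩
      by_cases hpS : p ∈ S
      · have hpcl : p ∉ closure V := fun h ↦ Set.disjoint_left.1 hdisj hpS (hclV h)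
        filter_upwards [isOpen_upperHalfPlaneSet.mem_nhds hpH,
          isClosed_closure.isOpen_compl.mem_nhds hpcl] with q hqH hqV
        exact ⟨hqH, fun h ↦ hqV (subset_closure h)⟩
      · have hpu : p ∈ u := by
          rcases hsuv ⟨hpH, hpS⟩ with h | h
          · exact h
          · exact absurd ⟨⟨hpH, hpS⟩, h⟩ hpV
        filter_upwards [isOpen_upperHalfPlaneSet.mem_nhds hpH, hu.mem_nhds hpu] with q hqH hqu
        refine ⟨hqH, fun hqV ↦ ?_⟩
        have : q ∈ (upperHalfPlaneSet \ S) ∩ (u ∩ v) := ⟨hqV.1, hqu, hqV.2⟩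
        rw [hsi] at this
        exact this
    have hHpre : IsPreconnected upperHalfPlaneSet := (convex_halfSpace_im_gt (0 : ℝ)).isPreconnected
    rw [isPreconnected_iff_subset_of_disjoint] at hHpre
    have hcover : upperHalfPlaneSet ⊆ V ∪ (upperHalfPlaneSet \ V) := fun z hz ↦ by
      by_cases h : z ∈ V
      · exact Or.inl h
      · exact Or.inr ⟨hz, h⟩
    rcases hHpre V (upperHalfPlaneSet \ V) hVo hW hcover (by
      rw [← subset_empty_iff]
      rintro z ⟨-, hzV, hzW⟩
      exact hzW.2 hzV) with h | h
    · exfalso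
      obtain ⟨z, hz⟩ := hU.nonempty
      have hzV := h hz.1
      have : z ∈ (upperHalfPlaneSet \ S) ∩ (u ∩ v) := ⟨hzV.1, hUu hz, hzV.2⟩
      rw [hsi] at this
      exact this
    · intro z hz
      rcases hsuv hz with hzu | hzv
      · exact hzu
      · exact absurd ⟨hz, hzv⟩ (h hz.1).2
  rw [isPreconnected_iff_subset_of_disjoint]
  intro u v hu hv hsuv hsi
  have hUpre := hU.isPreconnected
  rw [isPreconnected_iff_subset_of_disjoint] at hUpre
  rcases hUpre u v hu hv (hUsub.trans hsuv) (by
    rw [← subset_empty_iff, ← hsi]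
    exact inter_subset_inter_left _ hUsub) with h | h
  · exact Or.inl (key hu hv hsuv hsi h)
  · right
    exact key hv hu (by rwa [union_comm]) (by rwa [inter_comm v u]) h

/-- **A closed-open piece of a `*`-hull is a `*`-hull.** If the `*`-hull `A` is the disjoint
union of two closed sets `S` and `S'`, then `S ∈ 𝒬*`: `S` is a union of components of `A`, each
reaching the real axis, so `S = cl(S ∩ ℍ)`, `S ∪ {Im ≤ 0}` is connected and `ℍ ∖ S` is connected
(`isConnected_diff_piece`), hence simply connected (Conway (1978) Thm. VIII.2.2,
`Complex.isSimplyConnected_of_compl`). Registered sub-goal `stub_hullApproxDomain_piece` of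
STUB 4b (`stub_hullApproxDomain`). [cite: Conway1978, Ch. VIII Thm. 2.2 ((c)⇒(a))] -/
theorem stub_hullApproxDomain_piece :
    ∀ (A S S' : Set ℂ), IsStarHull A → IsClosed S → IsClosed S' → S ∪ S' = A → Disjoint S S' →
      IsStarHull S := by
  intro A S S' hA hSc hS'c hSS' hdisj
  have hAb := hA.isBoundedHull
  have hSA : S ⊆ A := hSS' ▸ subset_union_left
  have hnf := hAb.isConnected_union_im_nonpos
  -- components of `A` through points of `S` stay in `S`
  have hcomp : ∀ a ∈ S, connectedComponentIn A a ⊆ S := by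
    intro a ha
    have hpre := isPreconnected_connectedComponentIn (F := A) (x := a)
    rw [isPreconnected_iff_subset_of_disjoint_closed] at hpre
    rcases hpre S S' hSc hS'c (by rw [hSS']; exact connectedComponentIn_subset _ _) (by
      rw [hdisj.inter_eq, inter_empty]) with h | h
    · exact h
    · exact absurd (h (mem_connectedComponentIn (hSA ha))) (Set.disjoint_left.1 hdisj ha)
  -- `S = cl(S ∩ ℍ)`
  have hcl : closure (S ∩ upperHalfPlaneSet) = S := by
    refine Subset.antisymm (closure_minimal inter_subset_left hSc) fun a ha ↦ ?_
    have hO : IsOpen S'ᶜ := hS'c.isOpen_compl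
    have haO : a ∈ S'ᶜ := fun h ↦ Set.disjoint_left.1 hdisj ha h
    have hacl : a ∈ closure (A ∩ upperHalfPlaneSet) := by rw [hAb.closure_inter_eq]; exact hSA ha
    have h1 := hO.inter_closure ⟨haO, hacl⟩
    refine closure_mono ?_ h1
    rintro z ⟨hzO, hzA, hzH⟩
    exact ⟨(hSS'.symm.subset hzA).resolve_right hzO, hzH⟩
  -- `S ∪ {Im ≤ 0}` is connected
  set L : Set ℂ := {z : ℂ | z.im ≤ 0} with hL
  have hLc : IsPreconnected L := (convex_halfSpace_im_le 0).isPreconnected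
  have h0L : (0 : ℂ) ∈ L := by simp [hL]
  have hSL : IsConnected (S ∪ L) := by
    refine ⟨⟨0, Or.inr h0L⟩, ?_⟩
    rcases S.eq_empty_or_nonempty with he | hne
    · rw [he, empty_union]; exact hLc
    have heq : S ∪ L = ⋃ a : S, (connectedComponentIn A a ∪ L) := by
      refine Subset.antisymm ?_ (iUnion_subset fun a ↦ union_subset_union_left _ (hcomp a a.2))
      rintro z (hz | hz)
      · exact mem_iUnion.2 ⟨⟨z, hz⟩, Or.inl (mem_connectedComponentIn (hSA hz))⟩
      · obtain ⟨a, ha⟩ := hne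
        exact mem_iUnion.2 ⟨⟨a, ha⟩, Or.inr hz⟩
    rw [heq]
    refine isPreconnected_iUnion ⟨0, mem_iInter.2 fun a ↦ Or.inr h0L⟩ fun a ↦ ?_
    obtain ⟨x, -, hxa⟩ := hA.exists_real_mem_connectedComponentIn hnf (hSA a.2)
    exact isPreconnected_connectedComponentIn.union' ⟨x, hxa, by simp [hL]⟩ hLc
  -- `ℍ ∖ S` is simply connected
  have hconn := isConnected_diff_piece hA hSc hS'c hSS' hdisj
  have hsc : IsSimplyConnected (upperHalfPlaneSet \ S) := by
    -- adapted from `IsStarHull.isSimplyConnected_diff_sidePart` (HullDecomposition)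
    refine Complex.isSimplyConnected_of_compl (isOpen_upperHalfPlaneSet.sdiff hSc) hconn
      fun a ha hb ↦ ?_
    rw [AvoidanceDeterminesLaw.compl_diff_eq_union] at ha hb
    have hsub : L ⊆ connectedComponentIn (S ∪ L) a :=
      subset_union_right.trans (hSL.isPreconnected.subset_connectedComponentIn ha subset_rfl)
    obtain ⟨R, hR⟩ := (hb.subset hsub).subset_closedBall 0
    have hmem : (-((|R| + 1 : ℝ) : ℂ) * I) ∈ L := by
      show (-((|R| + 1 : ℝ) : ℂ) * I).im ≤ 0
      simp only [neg_mul, neg_im, mul_im, ofReal_re, I_im, mul_one, ofReal_im, I_re, mul_zero,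
        add_zero]
      linarith [abs_nonneg R]
    have := hR hmem
    rw [mem_closedBall_zero_iff, norm_mul, norm_neg, norm_real, norm_I, mul_one,
      Real.norm_of_nonneg (by positivity)] at this
    linarith [le_abs_self R]
  exact ⟨⟨hAb.1.subset hSA, hcl, hsc⟩, fun h0 ↦ hA.zero_notMem (hSA h0)⟩

end Summit.CriticalPhenomena.SAWScalingLimit.Theorems.ObservableToSLE.FloorRatio

end
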